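import Mathlib
import HarnessLib
import Summits.HubbardSuperconductivity.HubbardSuperconductivity.Theorems.KLProgrammeKLRegimeSplitSlotsV17F2
import Summits.HubbardSuperconductivity.HubbardSuperconductivity.Theorems.KLProgrammeKLRegimeSplitFrameLemmas

/-!
# Route `KLProgramme` — ENGINE item stmt-HubbardSuperconductivity-20437 `KLRegimeEngineV17F2`: THE DEGENERATE FRAME CLASS
# (`R.Gfr 0 = 0`) FORCES THE FLOW PIECES AND THE FLOW FRAME TO VANISH IDENTICALLY
# (cell gate-hubbard-kl, registrant seat gate-hubbard-kl-p1b g18; pen (R422)(B)(2) «DEGENERATE-CLASS AUDIT», registered-text half;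
# memo `DEGENERATE-R-SCREEN.md` cc90ee0d87d737ea, evidence on the item)

WHY.  The engine crux quantifies `∀ R, R.WF2 →` with `RenConsts.WF2 R = R.WF ∧ 0 < R.cr ∧ 0 < R.cz` and `R.WF = 0 ≤ cr ∧ 0 ≤ cz ∧ ∀ j, 0 ≤ Gfr j`, so
records with `R.Gfr 0 = 0` are admissible and every registered row of the skeleton (and every closed ∀R-hypothesis of a row closer) must hold for
them, although child 2 (`CountertermP2`, which CHOOSES `R`) never produces such an `R`.  The located item «(C)-HRES-GFR0-VACUITY» (p2 g27) and its
cure «GUARD-AND-SPLIT» (pen (R422)(B)) need the degenerate class reduced to the ZERO-FRAME situation.  This file provides exactly that reduction,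
from the rows' own hypotheses and nothing else:

* `evalM_eq_zero_of_frameOK_gfr_zero` — if `R.Gfr 0 = 0`, every `R`-admissible frame vanishes identically on `Momentum`: `FrameOK R U N μ K → ∀ q,
  evalM K q = 0` (the piece clause of `FrameOK` at derivative order `0` reads `‖Kp n (q)‖ ≤ R.Gfr 0 · uPow 0 U · 4^{-2n} = 0`, and `K = Σ Kp n`);
* `evalM_klFlowPiece_eq_zero_of_jets_gfr_zero` — if `R.Gfr 0 = 0`, the jets clause `FlowPieceJetsAt L M β U μ R j` (conjunct of the history's renorm
  slot `RenormFlowAtV17F`) forces `evalM (klFlowPiece L M β U μ j) ≡ 0`;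
* `evalM_klFlowPiece_eq_zero_of_histP_gfr_zero` — hence the HISTORY `HistP klPredsV17F2 L M G P Q R β U μ K n` forces every flow piece below `n`
  to vanish identically;
* `evalM_klFlowFrameU_eq_zero_of_histP_gfr_zero` — and therefore every flow frame `K_m`, `m ≤ n`, vanishes identically (`K₀ = 0`,
  `K_{m+1} = K_m ⊖ piece_m`, `evalM_fsub`); `evalM_frameShift_eq_zero_of_histP_gfr_zero` — in particular every frame SHIFT `K_{m+1} ⊖ K_m`,
  `m < n`, vanishes identically: on the degenerate class the cross-frame («frame-shift») terms of the engine rows are identically zero, so a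
  row's proof there is its ZERO-FRAME member (no Gfr₀-envelope can or need be used).

Elementary bookkeeping on definitions (no analysis); nothing here asserts any row of 20437, the cure, K3, the Kohn–Luttinger margin or
superconductivity in the Hubbard model.  0 kit · 0 lit.
References: BGM 2006 §2.4 (2.36) (the flowing-dispersion scheme whose frames these are) [cite: BenfattoGiulianiMastropietro2006].
-/

noncomputable section

namespace Summit.HubbardSuperconductivity.HubbardSuperconductivity.Theorems.KLRegimeSplit

set_option linter.dupNamespace false -- summit = problem name (single-conjunct summit), D-0017

open Real Finset Literature.MathematicalPhysics.QuantumLattice Literature.Probability.LatticeModels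
open Summit.HubbardSuperconductivity.HubbardSuperconductivity.Theorems.KLProgrammeLegKernels
open Summit.HubbardSuperconductivity.HubbardSuperconductivity.Theorems.DispersionFlow

/-! ## §1 Admissible frames vanish on the degenerate class -/

/-- **On the degenerate class `R.Gfr 0 = 0` every `R`-admissible frame vanishes identically**: the order-`0` member of `FrameOK`'s piece
clause bounds each piece by `R.Gfr 0 · uPow 0 U · 4^{(0-2)n} = 0`, and the frame is the sum of its pieces. -/
theorem evalM_eq_zero_of_frameOK_gfr_zero {R : RenConsts} {U : ℝ} {N : ℕ} {μ : ℝ} {K : TrigPolyC4v}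
    (hG : R.Gfr 0 = 0) (h : FrameOK R U N μ K) : ∀ q : Momentum, evalM K q = 0 := by
  intro q
  obtain ⟨-, Kp, hsum, hb⟩ := h
  have hpiece : ∀ n ≤ N, evalM (Kp n) q = 0 := by
    intro n hn
    have h0 := hb n hn 0 (by norm_num) q
    rw [norm_iteratedFDeriv_zero, hG, zero_mul, zero_mul] at h0
    exact norm_le_zero_iff.1 h0
  show K.eval (WithLp.ofLp q) = 0
  rw [hsum]
  refine Finset.sum_eq_zero fun n hn => ?_
  exact hpiece n (Nat.lt_succ_iff.1 (Finset.mem_range.1 hn))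

/-! ## §2 Flow pieces and flow frames vanish on the degenerate class -/

section Model

variable {L M : ℕ} [NeZero L] [NeZero M]

/-- **A flow piece with admissible jets vanishes identically on the degenerate class**: `FlowPieceJetsAt L M β U μ R j` at derivative order `0`
reads `‖evalM (klFlowPiece … j) q‖ ≤ R.Gfr 0 · uPow 0 U · 4^{-2j} = 0`. -/
theorem evalM_klFlowPiece_eq_zero_of_jets_gfr_zero {β U μ : ℝ} {R : RenConsts} {j : ℕ} (hG : R.Gfr 0 = 0)
    (h : FlowPieceJetsAt L M β U μ R j) : ∀ q : Momentum, evalM (klFlowPiece L M β U μ j) q = 0 := by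
  intro q
  have h0 := h 0 (by norm_num) q
  rw [norm_iteratedFDeriv_zero, hG, zero_mul, zero_mul] at h0
  exact norm_le_zero_iff.1 h0

/-- **The history forces every lower flow piece to vanish on the degenerate class**: the renorm slot of `HistP klPredsV17F2 … n` at each `j < n`
carries `FlowPieceJetsAt L M β U μ R j`. -/
theorem evalM_klFlowPiece_eq_zero_of_histP_gfr_zero {G : GeoConsts} {P : SplitConsts} {Q : EngConsts} {R : RenConsts} {β U μ : ℝ}
    {K : TrigPolyC4v} {n : ℕ} (hG : R.Gfr 0 = 0) (hh : HistP klPredsV17F2 L M G P Q R β U μ K n) :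
    ∀ j < n, ∀ q : Momentum, evalM (klFlowPiece L M β U μ j) q = 0 := fun j hj =>
  evalM_klFlowPiece_eq_zero_of_jets_gfr_zero hG ((histP_klPredsV17F2_iff L M G P Q R β U μ K n).1 hh j hj).2.1.2.1

/-- **The history forces every flow frame `K_m`, `m ≤ n`, to vanish identically on the degenerate class** (`K₀ = 0`, `K_{m+1} = K_m ⊖ piece_m`). -/
theorem evalM_klFlowFrameU_eq_zero_of_histP_gfr_zero {G : GeoConsts} {P : SplitConsts} {Q : EngConsts} {R : RenConsts} {β U μ : ℝ}
    {K : TrigPolyC4v} {n : ℕ} (hG : R.Gfr 0 = 0) (hh : HistP klPredsV17F2 L M G P Q R β U μ K n) :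
    ∀ m ≤ n, ∀ q : Momentum, evalM (klFlowFrameU L M β U μ m) q = 0 := by
  intro m
  induction m with
  | zero => intro _ q; simp [klFlowFrameU_zero, evalM]
  | succ m ih =>
    intro hm q
    rw [klFlowFrameU_succ, evalM_fsub, ih (Nat.le_of_succ_le hm) q,
      evalM_klFlowPiece_eq_zero_of_histP_gfr_zero hG hh m (Nat.lt_of_succ_le hm) q, sub_zero]

/-- **Every frame shift `K_{m+1} ⊖ K_m`, `m < n`, vanishes identically on the degenerate class** — the cross-frame terms of the engine rows are
identically zero there, so a row's proof on the degenerate class is its zero-frame member. -/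
theorem evalM_frameShift_eq_zero_of_histP_gfr_zero {G : GeoConsts} {P : SplitConsts} {Q : EngConsts} {R : RenConsts} {β U μ : ℝ}
    {K : TrigPolyC4v} {n : ℕ} (hG : R.Gfr 0 = 0) (hh : HistP klPredsV17F2 L M G P Q R β U μ K n) :
    ∀ m < n, ∀ q : Momentum, evalM (fsub (klFlowFrameU L M β U μ (m + 1)) (klFlowFrameU L M β U μ m)) q = 0 := by
  intro m hm q
  rw [evalM_fsub, evalM_klFlowFrameU_eq_zero_of_histP_gfr_zero hG hh (m + 1) hm q,
    evalM_klFlowFrameU_eq_zero_of_histP_gfr_zero hG hh m hm.le q, sub_zero]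

/-- **The scale-`n` flow frame itself vanishes identically on the degenerate class** whenever it is `R`-admissible — the `FrameOK R U N μ (K_n)`
binder of the rows, with no history needed. -/
theorem evalM_klFlowFrameU_eq_zero_of_frameOK_gfr_zero {R : RenConsts} {β U μ : ℝ} {N n : ℕ} (hG : R.Gfr 0 = 0)
    (h : FrameOK R U N μ (klFlowFrameU L M β U μ n)) : ∀ q : Momentum, evalM (klFlowFrameU L M β U μ n) q = 0 :=
  evalM_eq_zero_of_frameOK_gfr_zero hG h

end Model

end Summit.HubbardSuperconductivity.HubbardSuperconductivity.Theorems.KLRegimeSplit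

end
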